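import Literature.AlgebraicTopology.SingularHomology.ContractiblePunctured
import Literature.AlgebraicTopology.SingularHomology.HomologySpheresProofs
import Literature.AlgebraicTopology.SingularHomology.CohomologyMayerVietorisInjective
import Literature.AlgebraicTopology.SingularHomology.CohomologyMayerVietorisExtend
import Literature.AlgebraicTopology.SingularHomology.SuspensionIsomorphism
import Literature.AlgebraicTopology.Homotopy.HomotopyGroupsGeneralPosition
import Mathlib.Analysis.Normed.Module.Connected
import Mathlib.Geometry.Manifold.HasGroupoid
import HarnessLib

/-!
# Removing finitely many points from a manifold does not change `Hᵏ(-; ℤ)` below the top degrees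

Topic `Literature/AlgebraicTopology/SingularHomology`. Let `M` be a Hausdorff space charted on
`ℝᵈ`, `d ≥ 2`, `W ⊆ M` open and `V ⊆ W` with `W ∖ V` finite. Then the restriction
`Hᵏ(W; ℤ) → Hᵏ(V; ℤ)` (pull-back along the inclusion `V ↪ W`) is

* injective for `2 ≤ k`, `k ≠ d` (`map_inclusion_injective_of_finite_diff`), and
* surjective for `1 ≤ k`, `k + 1 ≠ d` (`map_inclusion_surjective_of_finite_diff`),

i.e. bijective for `2 ≤ k ≤ d - 2`. This is the statement "the local cohomology
`Hᵏ(M, M ∖ S; ℤ) ≅ ⊕_{s ∈ S} Hᵏ(ℝᵈ, ℝᵈ ∖ 0; ℤ)` of a finite set `S` is concentrated in degree `d`"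
(A. Hatcher, *Algebraic Topology* (2002), §3.3 p. 231, excision to a chart ball, with §3.1
pp. 203–204), proved here without relative cohomology: remove one point `P` at a time and apply
the Mayer–Vietoris sequence of the open cover `W = (W ∖ {P}) ∪ i(ℝᵈ)` by the punctured set and an
open cell `i : ℝᵈ ↪ W` centred at `P` (Hatcher §3.1 pp. 203–204; the tree's
`singularCohomology.eq_zero_of_map_subsetIncl_eq_zero` and
`singularCohomology.exists_map_subsetIncl_eq_of_isZero`): the cell is contractible and the overlap
`i(ℝᵈ) ∖ {P} ≅ ℝᵈ ∖ {0} ≃ Sᵈ⁻¹` has `Hʲ(ℝᵈ ∖ 0; ℤ) = 0` for `0 < j ≠ d - 1`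
(`isZero_singularCohomology_complZero`: the tree's `isIso_singularHomology_map_sphereToComplZero`,
`isHomologySphere_sphere` (Hatcher Cor. 2.14) and universal coefficients
`isZero_singularCohomology_of_isZero_of_free`, `injective_kroneckerMap_of_free_holds`
(Hatcher Thm. 3.2)).

Also recorded: the Mayer–Vietoris gluing statement on a union `A ∪ B` of two open subsets which
need not cover the ambient space (`singularCohomology.exists_of_map_inclusion_eq_union`, Hatcher
§3.1 pp. 203–204; the tree's `subsetCochains.exists_of_res_eq_res` read through
`subsetCochains.homologyIsoSingularCohomology`).

Consumer: the support calculus of integral classes on the complex points `X(ℂ)` (a `2n`-manifold)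
of a smooth projective variety — classes dying off a Zariski-closed `Z ⊆ X` are insensitive to
finitely many closed points added to `Z` (`Literature/Barriers/HodgeConjecture/IntegralCoefficientsSupport`,
for the Kollár barrier fact `Kollar1992_nonTorsionClass_notAlgebraic`).

Everything is proved; no named facts. Coefficients are `ℤ` (the sphere computation of the tree,
`isHomologySphere_sphere`, is integral).

## References

* A. Hatcher, *Algebraic Topology*, CUP 2002, §3.1 pp. 203–204 (Mayer–Vietoris in cohomology),
  §3.1 Thm. 3.2 and p. 196 (universal coefficients), Cor. 2.14 (homology of spheres), §3.3
  p. 231 (local homology at a point of a manifold). [HatcherAT2002]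
-/

noncomputable section

open CategoryTheory Limits Set Topology

namespace Literature.AlgebraicTopology.SingularHomology

/-! ### The integral (co)homology of punctured Euclidean space `ℝᵐ⁺¹ ∖ {0}` -/

section Punctured

variable (m : ℕ)

/-- `Hₖ(ℝᵐ⁺¹ ∖ {0}; ℤ) = 0` for `0 < k ≠ m`, `m ≥ 1`: `ℝᵐ⁺¹ ∖ {0} ≃ Sᵐ` on homology
(`isIso_singularHomology_map_sphereToComplZero`) and `Hₖ(Sᵐ; ℤ) = 0` for `0 < k ≠ m`
(Hatcher 2002, Cor. 2.14; `isHomologySphere_sphere`). [cite: HatcherAT2002, Cor. 2.14 and proof of Thm. 2.26] -/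
theorem isZero_singularHomology_complZero (hm : 1 ≤ m) {k : ℕ} (hk : 0 < k) (hkm : k ≠ m) :
    IsZero (singularHomology ℤ ℤ ↥(({0}ᶜ : Set (EuclideanSpace ℝ (Fin (m + 1))))) k) := by
  haveI := isIso_singularHomology_map_sphereToComplZero ℤ ℤ m k
  exact ((isHomologySphere_sphere hm).1 k hk hkm).of_iso
    (asIso (singularHomology.map ℤ ℤ (sphereToComplZero m) k)).symm

/-- `ℝᵐ⁺¹ ∖ {0}` is path connected for `m ≥ 1` (Mathlib
`isPathConnected_compl_singleton_of_one_lt_rank`). [folklore] -/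
theorem pathConnectedSpace_complZero (hm : 1 ≤ m) :
    PathConnectedSpace ↥(({0}ᶜ : Set (EuclideanSpace ℝ (Fin (m + 1))))) := by
  refine isPathConnected_iff_pathConnectedSpace.mp
    (isPathConnected_compl_singleton_of_one_lt_rank ?_ 0)
  rw [← Module.finrank_eq_rank, finrank_euclideanSpace_fin]
  exact_mod_cast (show 1 < m + 1 by omega)

/-- Every `Hₖ(ℝᵐ⁺¹ ∖ {0}; ℤ)`, `m ≥ 1`, is a free `ℤ`-module: `H₀ ≅ ℤ` (path connected, Hatcher
Prop. 2.7), `Hₖ = 0` for `0 < k ≠ m`, `Hₘ ≅ Hₘ(Sᵐ; ℤ) ≅ ℤ` (Hatcher Cor. 2.14).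
[cite: HatcherAT2002, Cor. 2.14 and Prop. 2.7] -/
theorem free_singularHomology_complZero (hm : 1 ≤ m) (k : ℕ) :
    Module.Free ℤ (singularHomology ℤ ℤ ↥(({0}ᶜ : Set (EuclideanSpace ℝ (Fin (m + 1))))) k) := by
  rcases Nat.eq_zero_or_pos k with rfl | hk
  · haveI := pathConnectedSpace_complZero m hm
    exact free_singularHomology_zero
  · by_cases hkm : k = m
    · subst hkm
      haveI := isIso_singularHomology_map_sphereToComplZero ℤ ℤ k k
      obtain ⟨e⟩ := (isHomologySphere_sphere hm).2
      exact Module.Free.of_equiv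
        (((asIso (singularHomology.map ℤ ℤ (sphereToComplZero k) k)).symm ≪≫ e).toLinearEquiv).symm
    · haveI := ModuleCat.subsingleton_of_isZero (isZero_singularHomology_complZero m hm hk hkm)
      infer_instance

/-- **`Hᵏ(ℝᵐ⁺¹ ∖ {0}; ℤ) = 0` for `0 < k ≠ m`**, `m ≥ 1` (Hatcher 2002, Cor. 2.14 with the universal
coefficient theorem Thm. 3.2 and p. 196: `Hᵏ ≅ Hom(Hₖ, ℤ) ⊕ Ext(Hₖ₋₁, ℤ)` with `Hₖ = 0` and `Hₖ₋₁`
free; the tree's `isZero_singularCohomology_of_isZero_of_free`,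
`injective_kroneckerMap_of_free_holds`). [cite: HatcherAT2002, Cor. 2.14, Thm. 3.2 and p. 196] -/
theorem isZero_singularCohomology_complZero (hm : 1 ≤ m) {k : ℕ} (hk : 0 < k) (hkm : k ≠ m) :
    IsZero (singularCohomology ℤ ℤ ↥(({0}ᶜ : Set (EuclideanSpace ℝ (Fin (m + 1))))) k) := by
  obtain ⟨j, rfl⟩ : ∃ j, k = j + 1 := ⟨k - 1, by omega⟩
  exact isZero_singularCohomology_of_isZero_of_free (injective_kroneckerMap_of_free_holds ℤ _ j)
    (free_singularHomology_complZero m hm j) (isZero_singularHomology_complZero m hm hk hkm)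

end Punctured

/-! ### Mayer–Vietoris gluing on a union of two open subsets -/

namespace singularCohomology

universe u

variable (R : Type u) [CommRing R] {X : Type u} [TopologicalSpace X]

/-- **Gluing cohomology classes on `A ∪ B`** (Hatcher 2002, §3.1 pp. 203–204, exactness of
Mayer–Vietoris at `Hᵖ(A) ⊕ Hᵖ(B)`), for `A`, `B` open in `X` (not necessarily covering `X`): classes
`a ∈ Hᵖ(↥A; R)`, `b ∈ Hᵖ(↥B; R)` with equal restrictions to `↥(A ∩ B)` are the restrictions of one
class `c ∈ Hᵖ(↥(A ∪ B); R)`. (The tree's `exists_of_map_inclusion_eq` is the case `A ∪ B = X`.)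
[cite: HatcherAT2002, §3.1 pp. 203–204] -/
theorem exists_of_map_inclusion_eq_union {A B : Set X} (hA : IsOpen A) (hB : IsOpen B)
    {p : ℕ} (a : singularCohomology R R (↥A) p) (b : singularCohomology R R (↥B) p)
    (h : map R R (ContinuousMap.inclusion (inter_subset_left : A ∩ B ⊆ A)) p a =
      map R R (ContinuousMap.inclusion (inter_subset_right : A ∩ B ⊆ B)) p b) :
    ∃ c : singularCohomology R R (↥(A ∪ B)) p,
      map R R (ContinuousMap.inclusion (subset_union_left : A ⊆ A ∪ B)) p c = a ∧
        map R R (ContinuousMap.inclusion (subset_union_right : B ⊆ A ∪ B)) p c = b := by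
  -- transport `a`, `b` to the cohomology computed in `C(X)`
  set a' := (subsetCochains.homologyIsoSingularCohomology R A p).inv a with ha'
  set b' := (subsetCochains.homologyIsoSingularCohomology R B p).inv b with hb'
  have haS : (subsetCochains.homologyIsoSingularCohomology R A p).hom a' = a := by
    rw [ha', ← ModuleCat.comp_apply, Iso.inv_hom_id, ModuleCat.id_apply]
  have hbS : (subsetCochains.homologyIsoSingularCohomology R B p).hom b' = b := by
    rw [hb', ← ModuleCat.comp_apply, Iso.inv_hom_id, ModuleCat.id_apply]
  have hres : subsetCochains.resH inter_subset_left p a' =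
      subsetCochains.resH inter_subset_right p b' := by
    apply ((forget (ModuleCat R)).mapIso
      (subsetCochains.homologyIsoSingularCohomology R (A ∩ B) p)).toEquiv.injective
    change (subsetCochains.homologyIsoSingularCohomology R (A ∩ B) p).hom _ =
      (subsetCochains.homologyIsoSingularCohomology R (A ∩ B) p).hom _
    rw [subsetCochains.homologyIsoSingularCohomology_hom_resH, haS,
      subsetCochains.homologyIsoSingularCohomology_hom_resH, hbS]
    exact h
  obtain ⟨d, hdA, hdB⟩ := subsetCochains.exists_of_res_eq_res (R := R) hA hB a' b' hres
  refine ⟨(subsetCochains.homologyIsoSingularCohomology R (A ∪ B) p).hom d, ?_, ?_⟩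
  · rw [← subsetCochains.homologyIsoSingularCohomology_hom_resH, hdA, haS]
  · rw [← subsetCochains.homologyIsoSingularCohomology_hom_resH, hdB, hbS]

end singularCohomology

/-! ### Removing one point from a manifold -/

section Point

variable {d : ℕ} {M : Type} [TopologicalSpace M] [T2Space M]
  [ChartedSpace (EuclideanSpace ℝ (Fin d)) M]

/-- **`Hᵏ(M; ℤ) → Hᵏ(M ∖ {P}; ℤ)` is injective for `2 ≤ k ≠ d`**, `M` a Hausdorff space charted on
`ℝᵈ`: Mayer–Vietoris for `M = (M ∖ {P}) ∪ i(ℝᵈ)`, `i` an open cell centred at `P` (contractible),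
with `Hᵏ⁻¹(i(ℝᵈ) ∖ {P}; ℤ) = Hᵏ⁻¹(ℝᵈ ∖ 0; ℤ) = 0` (Hatcher 2002, §3.1 pp. 203–204 and §3.3 p. 231).
[cite: HatcherAT2002, §3.1 pp. 203–204 and §3.3 p. 231] -/
theorem map_subsetIncl_compl_singleton_injective (hd : 2 ≤ d) (P : M) {k : ℕ} (hk : 2 ≤ k)
    (hkd : k ≠ d) :
    Function.Injective (singularCohomology.map ℤ ℤ (subsetIncl ({P}ᶜ : Set M)) k) := by
  obtain ⟨m, rfl⟩ : ∃ m, d = m + 1 := ⟨d - 1, by omega⟩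
  obtain ⟨i, hi, rfl⟩ := Literature.AlgebraicTopology.Homotopy.exists_isOpenEmbedding_apply_zero_eq
    (E := EuclideanSpace ℝ (Fin (m + 1))) P
  obtain ⟨j, rfl⟩ : ∃ j, k = j + 1 := ⟨k - 1, by omega⟩
  have hcover : ({i 0}ᶜ : Set M) ∪ range i = univ := by
    refine eq_univ_of_forall fun x ↦ ?_
    by_cases hx : x = i 0
    · exact Or.inr ⟨0, hx.symm⟩
    · exact Or.inl hx
  have hZ : IsZero (singularCohomology ℤ ℤ (↥(({i 0}ᶜ : Set M) ∩ range i)) j) :=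
    (isZero_singularCohomology_complZero m (by omega) (k := j) (by omega) (by omega)).of_iso
      (singularCohomology.mapIso ℤ ℤ (complZeroHomeomorphInter hi.isEmbedding) j)
  have hB : ∀ c : singularCohomology ℤ ℤ M (j + 1),
      singularCohomology.map ℤ ℤ (subsetIncl (range i)) (j + 1) c = 0 := fun c ↦ by
    haveI : ContractibleSpace ↥(range i) :=
      hi.isEmbedding.toHomeomorph.contractibleSpace_iff.mp inferInstance
    exact ModuleCat.eq_zero_of_isZero_obj
      (isZero_singularCohomology_of_contractibleSpace ℤ ℤ (↥(range i)) (Nat.succ_ne_zero j)) _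
  have key : ∀ c : singularCohomology ℤ ℤ M (j + 1),
      singularCohomology.map ℤ ℤ (subsetIncl ({i 0}ᶜ : Set M)) (j + 1) c = 0 → c = 0 :=
    fun c hc ↦ singularCohomology.eq_zero_of_map_subsetIncl_eq_zero ℤ isOpen_compl_singleton
      hi.isOpen_range hcover hZ c hc (hB c)
  intro a b hab
  have h := key (a - b) (by rw [map_sub, hab, sub_self])
  exact sub_eq_zero.mp h

/-- **`Hᵏ(M; ℤ) → Hᵏ(M ∖ {P}; ℤ)` is surjective for `1 ≤ k`, `k + 1 ≠ d`**, `M` a Hausdorff space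
charted on `ℝᵈ`: Mayer–Vietoris for `M = (M ∖ {P}) ∪ i(ℝᵈ)` with `Hᵏ(ℝᵈ ∖ 0; ℤ) = 0`
(Hatcher 2002, §3.1 pp. 203–204 and §3.3 p. 231). [cite: HatcherAT2002, §3.1 pp. 203–204 and §3.3 p. 231] -/
theorem map_subsetIncl_compl_singleton_surjective (hd : 2 ≤ d) (P : M) {k : ℕ} (hk : 1 ≤ k)
    (hkd : k + 1 ≠ d) :
    Function.Surjective (singularCohomology.map ℤ ℤ (subsetIncl ({P}ᶜ : Set M)) k) := by
  obtain ⟨m, rfl⟩ : ∃ m, d = m + 1 := ⟨d - 1, by omega⟩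
  obtain ⟨i, hi, rfl⟩ := Literature.AlgebraicTopology.Homotopy.exists_isOpenEmbedding_apply_zero_eq
    (E := EuclideanSpace ℝ (Fin (m + 1))) P
  have hcover : ({i 0}ᶜ : Set M) ∪ range i = univ := by
    refine eq_univ_of_forall fun x ↦ ?_
    by_cases hx : x = i 0
    · exact Or.inr ⟨0, hx.symm⟩
    · exact Or.inl hx
  have hZ : IsZero (singularCohomology ℤ ℤ (↥(({i 0}ᶜ : Set M) ∩ range i)) k) :=
    (isZero_singularCohomology_complZero m (by omega) (k := k) (by omega) (by omega)).of_iso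
      (singularCohomology.mapIso ℤ ℤ (complZeroHomeomorphInter hi.isEmbedding) k)
  intro a
  obtain ⟨c, hc, -⟩ := singularCohomology.exists_map_subsetIncl_eq_of_isZero ℤ
    isOpen_compl_singleton hi.isOpen_range hcover hZ a
  exact ⟨c, hc⟩

end Point

/-! ### Removing one point from an open subset -/

section OpenSubset

variable {d : ℕ} {M : Type} [TopologicalSpace M] [T2Space M]
  [ChartedSpace (EuclideanSpace ℝ (Fin d)) M]

omit [T2Space M] [ChartedSpace (EuclideanSpace ℝ (Fin d)) M] in
/-- For `W ⊆ M` open and `P ∈ W`, the inclusion `W ∖ {P} ↪ W` is, up to the tautological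
homeomorphism, the inclusion of the complement of the point `⟨P, hP⟩` of the subspace `↥W`.
[folklore] -/
theorem exists_homeomorph_inclusion_eq {W V : Set M} {P : M} (hP : P ∈ W) (hV : V = W \ {P})
    (hVW : V ⊆ W) :
    ∃ e : ↥V ≃ₜ ↥(({⟨P, hP⟩}ᶜ : Set ↥W)),
      (ContinuousMap.inclusion hVW : C(↥V, ↥W)) =
        (subsetIncl (({⟨P, hP⟩}ᶜ : Set ↥W))).comp (e : C(↥V, ↥(({⟨P, hP⟩}ᶜ : Set ↥W)))) := by
  subst hV
  refine ⟨{ toFun := fun x ↦ ⟨⟨x.1, x.2.1⟩, fun h ↦ x.2.2 (congrArg Subtype.val h)⟩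
            invFun := fun y ↦ ⟨y.1.1, y.1.2, fun h ↦ y.2 (Subtype.ext h)⟩
            left_inv := fun x ↦ rfl
            right_inv := fun y ↦ rfl
            continuous_toFun := by fun_prop
            continuous_invFun := by fun_prop }, ?_⟩
  ext x
  rfl

/-- **Removing one point from an open subset**: for `W ⊆ M` open and `V = W ∖ {P}`,
`Hᵏ(W; ℤ) → Hᵏ(V; ℤ)` is injective for `2 ≤ k ≠ d` (`↥W` is again a Hausdorff space charted on
`ℝᵈ`; if `P ∉ W` the map is an isomorphism). [cite: HatcherAT2002, §3.1 pp. 203–204 and §3.3 p. 231] -/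
theorem map_inclusion_injective_of_eq_diff_singleton (hd : 2 ≤ d) {W V : Set M} (hW : IsOpen W)
    (P : M) (hV : V = W \ {P}) (hVW : V ⊆ W) {k : ℕ} (hk : 2 ≤ k) (hkd : k ≠ d) :
    Function.Injective
      (singularCohomology.map ℤ ℤ (ContinuousMap.inclusion hVW : C(↥V, ↥W)) k) := by
  by_cases hP : P ∈ W
  · obtain ⟨e, he⟩ := exists_homeomorph_inclusion_eq hP hV hVW
    let U : TopologicalSpace.Opens M := ⟨W, hW⟩
    have hinj := map_subsetIncl_compl_singleton_injective (M := ↥U) hd ⟨P, hP⟩ hk hkd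
    rw [he, singularCohomology.map_comp]
    exact ((forget (ModuleCat ℤ)).mapIso
      (singularCohomology.mapIso ℤ ℤ e k)).toEquiv.injective.comp hinj
  · have hVW' : V = W := by rw [hV, Set.sdiff_singleton_eq_self hP]
    subst hVW'
    have hid : (ContinuousMap.inclusion hVW : C(↥V, ↥V)) = ContinuousMap.id _ := by ext; rfl
    rw [hid, singularCohomology.map_id]
    exact fun a b h ↦ h

/-- **Removing one point from an open subset**: for `W ⊆ M` open and `V = W ∖ {P}`,
`Hᵏ(W; ℤ) → Hᵏ(V; ℤ)` is surjective for `1 ≤ k`, `k + 1 ≠ d`.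
[cite: HatcherAT2002, §3.1 pp. 203–204 and §3.3 p. 231] -/
theorem map_inclusion_surjective_of_eq_diff_singleton (hd : 2 ≤ d) {W V : Set M} (hW : IsOpen W)
    (P : M) (hV : V = W \ {P}) (hVW : V ⊆ W) {k : ℕ} (hk : 1 ≤ k) (hkd : k + 1 ≠ d) :
    Function.Surjective
      (singularCohomology.map ℤ ℤ (ContinuousMap.inclusion hVW : C(↥V, ↥W)) k) := by
  by_cases hP : P ∈ W
  · obtain ⟨e, he⟩ := exists_homeomorph_inclusion_eq hP hV hVW
    let U : TopologicalSpace.Opens M := ⟨W, hW⟩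
    have hsurj := map_subsetIncl_compl_singleton_surjective (M := ↥U) hd ⟨P, hP⟩ hk hkd
    rw [he, singularCohomology.map_comp]
    exact ((forget (ModuleCat ℤ)).mapIso
      (singularCohomology.mapIso ℤ ℤ e k)).toEquiv.surjective.comp hsurj
  · have hVW' : V = W := by rw [hV, Set.sdiff_singleton_eq_self hP]
    subst hVW'
    have hid : (ContinuousMap.inclusion hVW : C(↥V, ↥V)) = ContinuousMap.id _ := by ext; rfl
    rw [hid, singularCohomology.map_id]
    exact fun a ↦ ⟨a, rfl⟩

end OpenSubset

/-! ### Removing finitely many points -/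

section Finite

variable {d : ℕ} {M : Type} [TopologicalSpace M] [T2Space M]
  [ChartedSpace (EuclideanSpace ℝ (Fin d)) M]

omit [TopologicalSpace M] [T2Space M] [ChartedSpace (EuclideanSpace ℝ (Fin d)) M] in
/-- Peeling one more point: `W ∖ insert P F = (W ∖ F) ∖ {P}`. [folklore] -/
theorem diff_insert_eq_diff_diff (W F : Set M) (P : M) : W \ insert P F = (W \ F) \ {P} := by
  rw [Set.sdiff_sdiff, union_comm, ← insert_eq]

/-- **Removing finitely many points, injectivity**: for `W ⊆ M` open and `V = W ∖ F` with `F`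
finite, `Hᵏ(W; ℤ) → Hᵏ(V; ℤ)` is injective for `2 ≤ k ≠ d` (induction on `F`, one point at a
time; Hatcher 2002, §3.3 p. 231 with §3.1 pp. 203–204).
[cite: HatcherAT2002, §3.3 p. 231 and §3.1 pp. 203–204] -/
theorem map_inclusion_injective_of_eq_diff_finite (hd : 2 ≤ d) {F : Set M} (hF : F.Finite) :
    ∀ {W V : Set M} (_ : IsOpen W) (_ : V = W \ F) (hVW : V ⊆ W) {k : ℕ} (_ : 2 ≤ k)
      (_ : k ≠ d),
      Function.Injective
        (singularCohomology.map ℤ ℤ (ContinuousMap.inclusion hVW : C(↥V, ↥W)) k) := by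
  induction F, hF using Set.Finite.induction_on with
  | empty =>
    intro W V hW hV hVW k hk hkd
    have hVW' : V = W := by rw [hV, Set.sdiff_empty]
    subst hVW'
    have hid : (ContinuousMap.inclusion hVW : C(↥V, ↥V)) = ContinuousMap.id _ := by ext; rfl
    rw [hid, singularCohomology.map_id]
    exact fun a b h ↦ h
  | @insert P F _ hF ih =>
    intro W V hW hV hVW k hk hkd
    have h1 : W \ F ⊆ W := Set.sdiff_subset
    have h2 : V ⊆ W \ F := by rw [hV]; exact Set.sdiff_subset_sdiff_right (subset_insert _ _)
    have hcomp : (ContinuousMap.inclusion hVW : C(↥V, ↥W)) =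
        (ContinuousMap.inclusion h1).comp (ContinuousMap.inclusion h2) := by ext; rfl
    have hA := ih hW rfl h1 hk hkd
    have hB := map_inclusion_injective_of_eq_diff_singleton hd (hW.sdiff hF.isClosed) P
      (by rw [hV, diff_insert_eq_diff_diff]) h2 hk hkd
    rw [hcomp, singularCohomology.map_comp]
    exact hB.comp hA

/-- **Removing finitely many points, surjectivity**: for `W ⊆ M` open and `V = W ∖ F` with `F`
finite, `Hᵏ(W; ℤ) → Hᵏ(V; ℤ)` is surjective for `1 ≤ k`, `k + 1 ≠ d`.
[cite: HatcherAT2002, §3.3 p. 231 and §3.1 pp. 203–204] -/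
theorem map_inclusion_surjective_of_eq_diff_finite (hd : 2 ≤ d) {F : Set M} (hF : F.Finite) :
    ∀ {W V : Set M} (_ : IsOpen W) (_ : V = W \ F) (hVW : V ⊆ W) {k : ℕ} (_ : 1 ≤ k)
      (_ : k + 1 ≠ d),
      Function.Surjective
        (singularCohomology.map ℤ ℤ (ContinuousMap.inclusion hVW : C(↥V, ↥W)) k) := by
  induction F, hF using Set.Finite.induction_on with
  | empty =>
    intro W V hW hV hVW k hk hkd
    have hVW' : V = W := by rw [hV, Set.sdiff_empty]
    subst hVW'
    have hid : (ContinuousMap.inclusion hVW : C(↥V, ↥V)) = ContinuousMap.id _ := by ext; rfl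
    rw [hid, singularCohomology.map_id]
    exact fun a ↦ ⟨a, rfl⟩
  | @insert P F _ hF ih =>
    intro W V hW hV hVW k hk hkd
    have h1 : W \ F ⊆ W := Set.sdiff_subset
    have h2 : V ⊆ W \ F := by rw [hV]; exact Set.sdiff_subset_sdiff_right (subset_insert _ _)
    have hcomp : (ContinuousMap.inclusion hVW : C(↥V, ↥W)) =
        (ContinuousMap.inclusion h1).comp (ContinuousMap.inclusion h2) := by ext; rfl
    have hA := ih hW rfl h1 hk hkd
    have hB := map_inclusion_surjective_of_eq_diff_singleton hd (hW.sdiff hF.isClosed) P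
      (by rw [hV, diff_insert_eq_diff_diff]) h2 hk hkd
    rw [hcomp, singularCohomology.map_comp]
    exact hB.comp hA

/-- **Removing finitely many points does not change `Hᵏ(-; ℤ)` for `2 ≤ k ≤ d - 2`, injectivity
half**: for `W ⊆ M` open and `V ⊆ W` with `W ∖ V` finite, `Hᵏ(W; ℤ) → Hᵏ(V; ℤ)` is injective for
`2 ≤ k ≠ d` (the local cohomology of a finite set in a `d`-manifold lives in degree `d`;
Hatcher 2002, §3.3 p. 231). [cite: HatcherAT2002, §3.3 p. 231 and §3.1 pp. 203–204] -/
theorem map_inclusion_injective_of_finite_diff (hd : 2 ≤ d) {W V : Set M} (hW : IsOpen W)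
    (hVW : V ⊆ W) (hfin : (W \ V).Finite) {k : ℕ} (hk : 2 ≤ k) (hkd : k ≠ d) :
    Function.Injective
      (singularCohomology.map ℤ ℤ (ContinuousMap.inclusion hVW : C(↥V, ↥W)) k) :=
  map_inclusion_injective_of_eq_diff_finite hd hfin hW (Set.sdiff_sdiff_cancel_left hVW).symm hVW
    hk hkd

/-- **Removing finitely many points does not change `Hᵏ(-; ℤ)` for `2 ≤ k ≤ d - 2`, surjectivity
half**: for `W ⊆ M` open and `V ⊆ W` with `W ∖ V` finite, `Hᵏ(W; ℤ) → Hᵏ(V; ℤ)` is surjective for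
`1 ≤ k`, `k + 1 ≠ d`. [cite: HatcherAT2002, §3.3 p. 231 and §3.1 pp. 203–204] -/
theorem map_inclusion_surjective_of_finite_diff (hd : 2 ≤ d) {W V : Set M} (hW : IsOpen W)
    (hVW : V ⊆ W) (hfin : (W \ V).Finite) {k : ℕ} (hk : 1 ≤ k) (hkd : k + 1 ≠ d) :
    Function.Surjective
      (singularCohomology.map ℤ ℤ (ContinuousMap.inclusion hVW : C(↥V, ↥W)) k) :=
  map_inclusion_surjective_of_eq_diff_finite hd hfin hW (Set.sdiff_sdiff_cancel_left hVW).symm hVW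
    hk hkd

end Finite

end Literature.AlgebraicTopology.SingularHomology

end
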